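import Summits.AnomalousDissipation.AnomalousDissipation.Theorems.MomentParityQuarticTightnessHorizonKrylovBogoliubov
import Summits.AnomalousDissipation.AnomalousDissipation.Theorems.MomentParityGalerkinInvariantLoudStubEnergyFloor
import Summits.AnomalousDissipation.AnomalousDissipation.Theorems.QuarticTightness.Negative.CubicCertificateBarrier

/-!
# Route MomentParity · crux `QuarticTightness` (stmt-AnomalousDissipation-14331), line `horizon-shooting`:
# stub S11 — the FIXED-VISCOSITY FLOOR (calibration)

Support file (`--supports stmt-AnomalousDissipation-14331`) of the line lead
(prover-line-stmt-AnomalousDissipation-14331-c13-0; skeleton `Cruxes/QuarticTightness/Lines/Ideate3Sketch.lean`).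
It proves the registered stub

* `stub_fixedViscosityFloor` (S11) — **every nonzero admissible force is loud-bounded-invariant at each FIXED
  small viscosity.** For `f` smooth, divergence-free, mean-zero, `f ≠ 0`, there is `ν₀ > 0` such that at every
  `0 < ν ≤ ν₀` there are budgets `E₀`, `ε₀ > 0` and a radius `R` with, for all large levels `N`, a law
  `μ` on `H` which is an `IsInvariantWitness f ν N R E₀ ε₀ μ` (probability, level-`N` carried, supported in
  `‖u‖ ≤ R`, all-order polynomially stationary for Galerkin NS at `(ν, f)`, energy `≤ E₀`, dissipation `≥ ε₀`).

Proof (all ingredients landed). EXISTENCE: shoot the ZERO datum. Its forward Galerkin orbit stays in the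
absorbing ball `‖u‖₂ ≤ R := ‖f‖₂/(4π²ν)` (`stub_absorbingBall`, zero mean along the orbit by `stub_meanZeroFlow`),
so every window has energy `≤ R²T`, and by the exact energy identity (`IsGalerkinMode.galerkinFlow_clauses`,
clause 5, from `u₀ = 0`) nonnegative work; the moving-base Krylov–Bogoliubov packaging
`stub_horizonKrylovBogoliubov` (ε' = 0, E' = R²) gives a bounded all-order-stationary level-`N` probability law.
LOUDNESS: such a law is in particular `2`-stationary with finite energy, so the linear-row energy floor
`GalerkinInvariantLoud.EnergyFloor.stub_energyFloor` gives `∫‖u‖²dμ ≥ e₀` for `ν ≤ ν₀`, `N ≥ N₀`, and Poincaré on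
`H` (`Torus.norm_sq_le_toReal_eGradNormSq`, `λ₁ = 4π²`) integrated over the level-`N` law
(`ensembleDissipation_eq_integral_dissDensity`) gives dissipation `ν∫‖∇u‖²dμ ≥ 4π²ν e₀ =: ε₀`. The budgets
depend on `ν` (`E₀ = R² ∝ ν⁻²`, `ε₀ ∝ ν`): the whole content of the line's open stub S6\* is their
`j`-uniformity as `ν_j → 0`.

Sources: Krylov–Bogoliubov / time-average measures of the Galerkin system (FMRT 2001, Ch. IV §2–3, App. B);
absorbing ball (Constantin–Foias 1988, Ch. 8, (8.7)–(8.9)); Poincaré on `H` (FMRT 2001, Ch. IV (1.13)).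
No new definitions; no theorem here concludes a Theses decl.
-/

noncomputable section

-- `Summit.<Summit>.<Problem>` is the tree's mandated summit-side namespace (CONVENTIONS §2); for this
-- single-conjunct summit the two coincide, so the duplicate is deliberate.
set_option linter.dupNamespace false

namespace Summit.AnomalousDissipation.AnomalousDissipation.Theorems.MomentParityQuarticTightness

open MeasureTheory Filter Topology Set Function
open scoped ENNReal InnerProductSpace RealInnerProductSpace
open Literature.Analysis.FunctionSpaces Literature.Analysis.FunctionSpaces.Torus
open Literature.Analysis.FluidPDE Literature.Analysis.FluidPDE.Torus
open Summit.AnomalousDissipation.AnomalousDissipation.Theses.MomentParity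
open Summit.AnomalousDissipation.AnomalousDissipation.Theorems
open Summit.AnomalousDissipation.AnomalousDissipation.Theorems.QuarticGate.Negative
open Summit.AnomalousDissipation.AnomalousDissipation.Theorems.QuarticTightness.Negative
open Summit.AnomalousDissipation.AnomalousDissipation.Theorems.CubicParityLoud.Negative (T3 R3 H3 L2T3)

/-! ## A. The zero datum shoots bounded windows with nonnegative work -/

/-- **The zero datum is horizon-admissible with budgets `(R², 0)`.** For `f` smooth mean-zero and `ν > 0`, at
every level `N` and every horizon `T > 0` the zero field is a mean-zero Galerkin datum in the absorbing ball
`R = ‖f‖₂/(4π²ν)` whose window has work `≥ 0 · T` (exact energy identity from `u₀ = 0`: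
work `= ½‖u_T‖² + ν∫₀ᵀ‖∇u‖² ≥ 0`) and energy `≤ R² T` (the absorbing ball is forward invariant,
`stub_absorbingBall`, the orbit staying mean-zero by `stub_meanZeroFlow`). [folklore] -/
theorem zero_datum_horizon {f : T3 → R3} (hfs : Torus.IsSmooth f) (hfz : Torus.HasZeroMean f)
    {ν : ℝ} (hν : 0 < ν) (N : ℕ) {T : ℝ} (hT : 0 < T) :
    ∃ a : T3 → R3, IsGalerkinMode N a ∧ Torus.HasZeroMean a ∧
      ∫ x, ‖a x‖ ^ 2 ≤ (Real.sqrt (∫ x, ‖f x‖ ^ 2) / (4 * Real.pi ^ 2 * ν)) ^ 2 ∧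
      0 * T ≤ ∫ t in (0 : ℝ)..T, ∫ x, ⟪f x, Torus.galerkinFlow ν f N t a x⟫_ℝ ∧
      ∫ t in (0 : ℝ)..T, ∫ x, ‖Torus.galerkinFlow ν f N t a x‖ ^ 2 ≤
        (Real.sqrt (∫ x, ‖f x‖ ^ 2) / (4 * Real.pi ^ 2 * ν)) ^ 2 * T := by
  set R : ℝ := Real.sqrt (∫ x, ‖f x‖ ^ 2) / (4 * Real.pi ^ 2 * ν) with hRdef
  have ha : IsGalerkinMode N (0 : T3 → R3) := isGalerkinMode_zero N
  have ha0 : Torus.HasZeroMean (0 : T3 → R3) := by simp [Torus.HasZeroMean]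
  have haR : ∫ x, ‖(0 : T3 → R3) x‖ ^ 2 ≤ R ^ 2 := by
    simp only [Pi.zero_apply, norm_zero, ne_eq, OfNat.ofNat_ne_zero, not_false_eq_true, zero_pow,
      integral_zero]
    positivity
  refine ⟨0, ha, ha0, haR, ?_, ?_⟩
  · -- window work `≥ 0`: the exact energy identity from the zero datum
    rw [zero_mul]
    have h5 := (ha.galerkinFlow_clauses hν.le (hfs.memLp 2)).2.2.2.2 0 T le_rfl hT.le
    rw [Torus.galerkinFlow_zero] at h5
    have hk0 : kineticEnergy (0 : T3 → R3) = 0 := by simp [kineticEnergy]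
    have hk1 : 0 ≤ kineticEnergy (Torus.galerkinFlow ν f N T (0 : T3 → R3)) := kineticEnergy_nonneg _
    have hd : 0 ≤ ν * (∫⁻ τ in Ioo 0 T, eGradNormSq (Torus.galerkinFlow ν f N τ (0 : T3 → R3))).toReal :=
      mul_nonneg hν.le ENNReal.toReal_nonneg
    linarith
  · -- window energy `≤ R² T`: the absorbing ball along the (mean-zero) orbit
    have hmean : ∀ t, 0 ≤ t → Torus.HasZeroMean (Torus.galerkinFlow ν f N t (0 : T3 → R3)) :=
      fun t ht => stub_meanZeroFlow ν f N 0 hν.le hfs hfz ha ha0 t ht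
    have hpt : ∀ t, 0 ≤ t → ∫ x, ‖Torus.galerkinFlow ν f N t (0 : T3 → R3) x‖ ^ 2 ≤ R ^ 2 :=
      fun t ht => stub_absorbingBall ν f N 0 hν hfs ha hmean le_rfl haR t ht
    have hb := intervalIntegral.norm_integral_le_of_norm_le_const (a := (0 : ℝ)) (b := T) (C := R ^ 2)
      (f := fun t => ∫ x, ‖Torus.galerkinFlow ν f N t (0 : T3 → R3) x‖ ^ 2) ?_
    · rw [sub_zero, abs_of_pos hT] at hb
      exact (Real.le_norm_self _).trans hb
    · intro t ht
      rw [uIoc_of_le hT.le] at ht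
      rw [Real.norm_of_nonneg (integral_nonneg fun x => by positivity)]
      exact hpt t ht.1.le

/-! ## B. Poincaré floor for the dissipation of a bounded level-`N` law -/

/-- **Poincaré on `H`, integrated**: a level-`N` law supported in a ball has
`4π²ν ∫‖u‖²dμ ≤ ν∫‖∇u‖²dμ = ensembleDissipation ν μ` (`ν ≥ 0`; `λ₁ = 4π²` on the mean-zero solenoidal
space, `Torus.norm_sq_le_toReal_eGradNormSq`; the enstrophy is a Bochner integral on level-`N` laws,
`ensembleDissipation_eq_integral_dissDensity`). [folklore] -/
theorem ensembleEnergy_le_ensembleDissipation {ν : ℝ} (hν : 0 ≤ ν) {N : ℕ} {R : ℝ} {μ : Measure H3}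
    [IsFiniteMeasure μ] (hlev : ∀ᵐ u ∂μ, IsLevel N u) (hball : ∀ᵐ u ∂μ, ‖u‖ ≤ R) :
    4 * Real.pi ^ 2 * ν * Torus.ensembleEnergy μ ≤ Torus.ensembleDissipation ν μ := by
  have h2 : Integrable (fun u : H3 => ‖u‖ ^ 2) μ := integrable_norm_pow_of_ae_le hball 2
  have hP : ∀ᵐ u ∂μ, 4 * Real.pi ^ 2 * ‖u‖ ^ 2 ≤ dissDensity u := hlev.mono fun u hu =>
    Torus.norm_sq_le_toReal_eGradNormSq u (CubicParityLoud.Negative.eGradNormSq_lt_top_of_isLevel hu).ne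
  rw [ensembleDissipation_eq_integral_dissDensity (ν := ν) hlev]
  calc 4 * Real.pi ^ 2 * ν * Torus.ensembleEnergy μ = ν * ∫ u, 4 * Real.pi ^ 2 * ‖u‖ ^ 2 ∂μ := by
        unfold Torus.ensembleEnergy
        rw [integral_const_mul]
        ring
    _ ≤ ν * ∫ u, dissDensity u ∂μ :=
        mul_le_mul_of_nonneg_left (integral_mono_ae (h2.const_mul _) (integrable_dissDensity hlev h2) hP) hν

/-! ## C. The registered stub -/

/-- **S11 — THE FIXED-VISCOSITY FLOOR (calibration; registered stub of the line `horizon-shooting`).** For every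
smooth divergence-free mean-zero force `f ≠ 0` there is `ν₀ > 0` such that at every FIXED viscosity
`0 < ν ≤ ν₀` there are budgets `E₀`, `ε₀ > 0` and a radius `R` with, for all large levels `N`, a loud bounded
Galerkin-invariant level-`N` law: an `IsInvariantWitness f ν N R E₀ ε₀ μ`. Here `R = ‖f‖₂/(4π²ν)` (absorbing
radius), `E₀ = R²`, `ε₀ = 4π²ν e₀` with `(e₀, ν₀, N₀)` the linear-row energy floor of
`GalerkinInvariantLoud.EnergyFloor.stub_energyFloor`. Existence: the zero datum shoots bounded windows with
nonnegative work at every horizon (`zero_datum_horizon`), and the moving-base Krylov–Bogoliubov packaging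
`stub_horizonKrylovBogoliubov` (ε' = 0) yields a bounded all-order-stationary probability law; loudness: it is
`2`-stationary with finite energy, so `∫‖u‖²dμ ≥ e₀`, and Poincaré (`ensembleEnergy_le_ensembleDissipation`)
gives dissipation `≥ 4π²ν e₀`. The budgets are `ν`-dependent; their `j`-uniformity along `ν_j → 0` is the
content of the line's open stub. [folklore] -/
theorem stub_fixedViscosityFloor :
    ∀ f : T3 → R3, Torus.IsSmooth f → Torus.IsDivFree f → Torus.HasZeroMean f → f ≠ 0 →
    ∃ ν₀ : ℝ, 0 < ν₀ ∧ ∀ ν : ℝ, 0 < ν → ν ≤ ν₀ →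
      ∃ E₀ ε₀ : ℝ, 0 < ε₀ ∧ ∃ R : ℝ, ∀ᶠ N in atTop, ∃ μ : Measure H3, IsInvariantWitness f ν N R E₀ ε₀ μ := by
  intro f hfs hfd hfz hf0
  obtain ⟨e₀, ν₀, he₀, hν₀, N₀, hfloor⟩ :=
    GalerkinInvariantLoud.EnergyFloor.stub_energyFloor f hfs hfd hfz hf0
  refine ⟨ν₀, hν₀, fun ν hν hνle => ?_⟩
  set R : ℝ := Real.sqrt (∫ x, ‖f x‖ ^ 2) / (4 * Real.pi ^ 2 * ν) with hRdef
  refine ⟨R ^ 2, 4 * Real.pi ^ 2 * ν * e₀, by positivity, R, ?_⟩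
  filter_upwards [eventually_ge_atTop N₀] with N hN
  -- existence: Krylov–Bogoliubov from the zero datum
  obtain ⟨μ, hw⟩ := stub_horizonKrylovBogoliubov hfs hfz hν (N := N) (E' := R ^ 2) (ε' := 0)
    fun T hT => zero_datum_horizon hfs hfz hν N hT
  obtain ⟨hP, hlev, hball, hstat, hE, -⟩ := hw
  haveI := hP
  -- loudness: energy floor from the linear row, then Poincaré
  have h2 : Integrable (fun u : H3 => ‖u‖ ^ 2) μ := integrable_norm_pow_of_ae_le hball 2
  have hfl : e₀ ≤ Torus.ensembleEnergy μ :=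
    hfloor ν hν hνle N hN μ hP hlev h2 fun m g P hg _ => hstat m g P hg
  refine ⟨μ, hP, hlev, hball, hstat, hE, ?_⟩
  calc 4 * Real.pi ^ 2 * ν * e₀ ≤ 4 * Real.pi ^ 2 * ν * Torus.ensembleEnergy μ :=
        mul_le_mul_of_nonneg_left hfl (by positivity)
    _ ≤ Torus.ensembleDissipation ν μ := ensembleEnergy_le_ensembleDissipation hν.le hlev hball

end Summit.AnomalousDissipation.AnomalousDissipation.Theorems.MomentParityQuarticTightness

end
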